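import Literature.MathematicalPhysics.QuantumFieldTheory.Balaban1983to89.Node00.BgSchemeOfRecord
import Summits.QuantumFields.YangMills.Theorems.BalabanUVNodesN07HessOpOfRecordSymmetric
import Summits.QuantumFields.YangMills.Theorems.BalabanUVNodesN07ConstraintLetterFderiv
import Literature.MathematicalPhysics.QuantumFieldTheory.Balaban1983to89.B9Eq3119DeltaPiCarrier
import HarnessLib

/-!
# NODE N07 — THREE DISPLAYED TOKENS OF def-Y's SCHEME OF RECORD (✓3g′ `Node00.BgSchemeOfRecord`) DISCHARGED FROM THE N07 LANE: `HessSymmTok Δ2` (⇐ `Δ2` Hilbert-symmetric;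
# unconditional at `Δ2 = 0`), `C1Tok levB` (⇐ the small-field guard on `U₀`), `Delta2SymmTok Δ2` (⇐ `Δ2` symmetric for the bilinear trace pairing; unconditional at `Δ2 = 0`)

Cell `pub-ymgap`, width seat `pub-ymgap-dag-n07-w3` (g25), INTENT-10 ∕ CLAIM-10.  `--kind proof --supports stmt-QuantumFields-27238 --as helper`; count-neutral.
[15] = [Balaban1985Variational]; [B9] = [Balaban1985BackgroundPropagators].

WHAT.  3g′ assembles [15] Prop. 6's scheme at a displayed background `U₀` and reads it with DISPLAYED tokens (never asserted there).  Three of them are, by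
name, theorems this lane landed today:
* §1 `hessSymmTok_of_isSymmetric` — `HessSymmTok F N K k U₀ Δ2 := (Δ(U₀) + Δ2).IsSymmetric` from `Δ2.IsSymmetric` (✓p819846 `hessOpOfRecord_add_isSymmetric`: `Δ(U₀)` is
  symmetric at EVERY background); `hessSymmTok_zero` — slot (b), no hypothesis.
* §2 ★★★ `c1Tok_of_smallBelow` — `C1Tok F N K k Ω U₀ levB := HasFDerivAt C^{𝔰𝔩} 0 0` at every GUARDED background (✓p819682 `hasFDerivAt_COfRecord_comp_zero` at
  `P := slProjLit`, whose presented values are traceless by 3f′ ✓`evLit_slProjLit` ∕ lit ✓`trace_slProj`): (44)∕(56) «`C` is of second order» on print's `𝔤ᶜ`-valued fields.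
* §3 `delta2SymmTok_of_tpair_comm` — `Delta2SymmTok F N K k Ω U₀ Δ2` from the bilinear-trace symmetry `∀ x y, (x, Δ2 y) = (y, Δ2 x)` (lit ✓`pairSum_currentCLM_comm`,
  ✓`pair27_eq_sum`); `delta2SymmTok_zero`.

HONEST LABELS.  Glue: three displayed tokens reduced to (resp. discharged from) structural hypotheses; `RegimeTok` (Prop. 6's regime (117)–(121): Bałaban's estimates),
`ChartSUTok`, `Delta2Tok` ((3.134), existence of `Δ2`), `Prop7Tok`, `UniqTok`, [B9] Thms 3.11–3.13 are NOT touched.  Count-neutral; N07 NOT discharged; P0 ⟨26900⟩ OPEN;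
R4 is the conditional finite-𝕋⁴ rung only.  Nothing here is a claim about the Yang–Mills mass gap (`Summit.QuantumFields`): finite torus, fixed `ε`; nothing continuum ∕ OS ∕ Clay.
-/

set_option autoImplicit false

noncomputable section

open scoped Matrix Matrix.Norms.L2Operator InnerProductSpace ComplexConjugate BigOperators

namespace Summit.QuantumFields.YangMills.Theorems.N07SchemeTokensOfRecord

open Literature.MathematicalPhysics.QuantumFieldTheory.Balaban1983to89
open Literature.MathematicalPhysics.QuantumFieldTheory.Balaban1983to89.T4Continuum (T4Family)
open T4Continuum BlockAveraging
open B9Eq311TracePairing (tpair)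
open B11Eq111FrakG (nabla115)
open B11Eq103H1Complex (BondL2K)
open B11Eq90Transpose (pair27_eq_sum)
open B9Eq3119DeltaPiCarrier (pairSum_currentCLM_comm)
open B12Lemma4Models (trace_slProj)
open Node00
open Summit.QuantumFields.YangMills.Theorems.N07HessOpOfRecordSymmetric (hessOpOfRecord_add_isSymmetric tauRec_mul_comm)
open Summit.QuantumFields.YangMills.Theorems.N07ConstraintLetterFderiv (hasFDerivAt_COfRecord_comp_zero)

variable (F : T4Family) (N : ℕ) (K : ℕ) (k : ℕ) (Ω : ℕ → Set (Site (F.P K) 0)) (U₀ : GaugeField (F.P K) 0 (SU N))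

/-! ## §1  `HessSymmTok` -/

/-- ★ **`HessSymmTok Δ2` FROM `Δ2` HILBERT-SYMMETRIC** — `Δ(U₀)` itself is symmetric at every background (✓`hessOpOfRecord_add_isSymmetric`).
[cite: Balaban1985BackgroundPropagators, (3.10) p.392, (3.124) p.420, (3.128) p.421] -/
theorem hessSymmTok_of_isSymmetric [Fact (0 < c0Rec F K k)]
    {Δ2 : BondL2K ℂ (F.P K).d (fun _ => (F.P K).sitesPerDir 0) (c0Rec F K k) (WRec N) →ₗ[ℂ]
      BondL2K ℂ (F.P K).d (fun _ => (F.P K).sitesPerDir 0) (c0Rec F K k) (WRec N)} (hΔ2 : Δ2.IsSymmetric) :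
    HessSymmTok F N K k U₀ Δ2 :=
  hessOpOfRecord_add_isSymmetric F N k U₀ hΔ2

/-- **`HessSymmTok 0`** — slot (b) (`Δ⁽²⁾ := 0`), no hypothesis. [cite: Balaban1985BackgroundPropagators, (3.10) p.392, (3.119) p.419] -/
theorem hessSymmTok_zero [Fact (0 < c0Rec F K k)] : HessSymmTok F N K k U₀ 0 :=
  hessSymmTok_of_isSymmetric F N K k U₀ LinearMap.IsSymmetric.zero

/-! ## §2  `C1Tok` at every guarded background -/

/-- ★★★ **`C1Tok levB` — `DC^{𝔰𝔩}(0) = 0` WITH DIFFERENTIABILITY — AT EVERY GUARDED BACKGROUND** ((44)∕(56) «`C` is of second order» on print's `𝔤ᶜ`-valued fields):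
✓`hasFDerivAt_COfRecord_comp_zero` at `P := slProjLit` (presented values traceless: ✓`evLit_slProjLit`, ✓`trace_slProj`); `CslOfRecord = COfRecord ∘ slProjLit` by `rfl`.
[cite: Balaban1985Variational, (44) p.285, (56) p.286, (51) p.286] -/
theorem c1Tok_of_smallBelow [NeZero N] [Fact (0 < (F.L : ℝ))] [Fact (0 < (F.P K).eta k)] (levB : PBond (F.P K) k → ℕ)
    (hU₀ : SmallBelow (avOfRecord F N K) k U₀) : C1Tok F N K k Ω U₀ levB :=
  hasFDerivAt_COfRecord_comp_zero F k Ω U₀ levB hU₀ (slProjLit F N K k Ω U₀) fun A b => by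
    rw [evLit_slProjLit]; exact trace_slProj _

/-! ## §3  `Delta2SymmTok` -/

/-- ★ **`Delta2SymmTok Δ2` FROM THE BILINEAR-TRACE SYMMETRY OF `Δ2`** (`∀ x y, (x, Δ2 y) = (y, Δ2 x)` for `(f, g) = Σ_b c₀ tr(f(b)g(b))`): the current reading of `Δ2` is then
(27)-symmetric (lit ✓`pairSum_currentCLM_comm`, cyclic trace). [cite: Balaban1985Variational, (27) p.282; Balaban1985BackgroundPropagators, (3.134)–(3.135) p.422] -/
theorem delta2SymmTok_of_tpair_comm [NeZero N] [Fact (0 < (F.L : ℝ))] [Fact (0 < (F.P K).eta k)] [Fact (0 < c0Rec F K k)]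
    {Δ2 : BondL2K ℂ (F.P K).d (fun _ => (F.P K).sitesPerDir 0) (c0Rec F K k) (WRec N) →ₗ[ℂ]
      BondL2K ℂ (F.P K).d (fun _ => (F.P K).sitesPerDir 0) (c0Rec F K k) (WRec N)}
    (hT : ∀ x y, tpair (phiRec N) (tauRec N) x (Δ2 y) = tpair (phiRec N) (tauRec N) y (Δ2 x)) :
    Delta2SymmTok F N K k Ω U₀ Δ2 := by
  intro Y Z
  rw [pair27_eq_sum, pair27_eq_sum]
  exact pairSum_currentCLM_comm (phiRec N) (tauRec N) (pairLevLit F Ω k) (nabla115 ((F.P K).eta k) (unitsOfRecord F N U₀))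
    (tauRec_mul_comm N) hT Y Z

/-- **`Delta2SymmTok 0`** — slot (b), no hypothesis. [cite: Balaban1985BackgroundPropagators, (3.119) p.419, (3.134) p.422] -/
theorem delta2SymmTok_zero [NeZero N] [Fact (0 < (F.L : ℝ))] [Fact (0 < (F.P K).eta k)] [Fact (0 < c0Rec F K k)] :
    Delta2SymmTok F N K k Ω U₀ 0 :=
  delta2SymmTok_of_tpair_comm F N K k Ω U₀ fun x y => by
    simp only [LinearMap.zero_apply, B9Eq311TracePairing.tpair_def, B9Eq311L2Pairing.WL2.equiv_zero, Pi.zero_apply, map_zero, mul_zero,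
      Finset.sum_const_zero]

end Summit.QuantumFields.YangMills.Theorems.N07SchemeTokensOfRecord
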